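import Literature.NumberTheory.ZetaValues.AperyLikeGeneratingFunctions
import HarnessLib

/-!
# The Markov–WZ pair behind the Cohen–Rivoal bivariate Apéry-like identity (Hessami Pilehrood 2008)

Topic `Literature/NumberTheory/ZetaValues`. Source: Kh. Hessami Pilehrood, T. Hessami Pilehrood, *Simultaneous
generation for zeta values by the Markov–WZ method*, DMTCS **10**:3 (2008) 115–123 = arXiv:0801.3310
[HessamiPilehrood2008MarkovWZ], Theorem 1 and its proof (§2), specialised to `B₀ = 1`, `A₀ = C₀ = 0` (so that the
auxiliary sequence `L(n)` vanishes identically and the Markov–WZ pair is explicit, §2 (eq06)–(eq14)), and written in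
the variables of the tree's `rivoal2004_theorem11` (`AperyLikeGeneratingFunctions.lean`): the substitution (ab) of the
source, `a² + b² = x²`, `a²b² = −y⁴`, turns `(m² − a²)(m² − b²)` into `P(m) = m⁴ − x²m² − y⁴` and
`(m² − a² − b²)² − 4a²b²` into `R(m) = (m² − x²)² + 4y⁴`; below `(x, y)` are called `(a, b)` as in the tree.

The pair (kernel `H(n,k) = 1/∏_{m=k+1}^{n+k+1} P(m)`, `κ_n = (−1)ⁿ n! ∏_{m≤n} R(m)/(2^{n+1} ∏_{m≤n} (2m+1))`):
`F(n,k) = κ_n (2n+1)(n+2k+2) H(n,k)` (`= H·(A(n) + B(n)(k+1))` of the source) and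
`G(n,k) = κ_n ((5(n+1)² − a²)/2 + 3(n+1)k + k²) H(n,k)` (`= H·(D(n) + E(n)k + K(n)k²)`). PROVED here:
* `cohenRivoal_wz` — the Markov–WZ relation `F(n+1,k) − F(n,k) = G(n,k+1) − G(n,k)` ((eq04); a rational identity,
  valid whenever no `P(m)`, `m ≥ 1`, vanishes);
* `cohenRivoal_F_zero` — `F(0,k) = (k+1)/P(k+1)`, the general term of the left-hand side of [Rivoal2004, Thm 1.1];
* `cohenRivoal_G_zero` — `G(n,0) = ½ · rivoalTerm a b (n+1)`, the general term of its right-hand side;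
* `cohenRivoal_P_ne_zero` — `P(m) ≠ 0` for `m ≥ 1` when `‖a‖² + ‖b‖⁴ < 1` (indeed `‖P(m)‖ ≥ m²(m² − ‖a‖² − ‖b‖⁴)`).
The summation (the source's §3 / the tree's `WZSummation.lean`) and the estimates that make the boundary terms vanish
are in the sibling `CohenRivoalProofs.lean`, which discharges `rivoal2004_theorem11`. No definitions: `F`, `G` appear
as `let`-bound lambdas in the statements.
-/

open Finset

noncomputable section

namespace Literature.NumberTheory.ZetaValues

/-- For `‖a‖² + ‖b‖⁴ < 1` and real `x ≥ 1`: `‖x⁴ − a²x² − b⁴‖ ≥ x²(x² − (‖a‖² + ‖b‖⁴)) > 0`; in particular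
`P(m) = m⁴ − a²m² − b⁴ ≠ 0` for every integer `m ≥ 1` (the denominators of [Rivoal2004, Thm 1.1] do not vanish).
[cite: HessamiPilehrood2008MarkovWZ, Theorem 2 (hypothesis |x|²+|y|⁴<1)] [cite: Rivoal2004, Theorem 1.1 p. 504] -/
theorem cohenRivoal_norm_P_ge (a b : ℂ) {x : ℝ} (hx : 1 ≤ x) :
    x ^ 2 * (x ^ 2 - (‖a‖ ^ 2 + ‖b‖ ^ 4)) ≤ ‖((x : ℂ)) ^ 4 - a ^ 2 * ((x : ℂ)) ^ 2 - b ^ 4‖ := by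
  have h1 : ‖((x : ℂ)) ^ 4‖ = x ^ 4 := by
    rw [norm_pow, Complex.norm_real, Real.norm_of_nonneg (by linarith)]
  have h2 : ‖a ^ 2 * ((x : ℂ)) ^ 2 + b ^ 4‖ ≤ ‖a‖ ^ 2 * x ^ 2 + ‖b‖ ^ 4 := by
    refine (norm_add_le _ _).trans ?_
    rw [norm_mul, norm_pow, norm_pow, norm_pow, Complex.norm_real, Real.norm_of_nonneg (by linarith)]
  have h3 : ‖((x : ℂ)) ^ 4 - a ^ 2 * ((x : ℂ)) ^ 2 - b ^ 4‖ ≥ ‖((x : ℂ)) ^ 4‖ - ‖a ^ 2 * ((x : ℂ)) ^ 2 + b ^ 4‖ := by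
    rw [sub_sub]; exact norm_sub_norm_le _ _
  have hb : ‖b‖ ^ 4 ≤ ‖b‖ ^ 4 * x ^ 2 := le_mul_of_one_le_right (by positivity) (by nlinarith)
  nlinarith [norm_nonneg a, norm_nonneg b]

/-- `P(m) ≠ 0` for integers `m ≥ 1` when `‖a‖² + ‖b‖⁴ < 1`. [cite: Rivoal2004, Theorem 1.1 p. 504 (the hypothesis |a|²+|b|⁴<1)] -/
theorem cohenRivoal_P_ne_zero {a b : ℂ} (hab : ‖a‖ ^ 2 + ‖b‖ ^ 4 < 1) (m : ℕ) :
    ((m : ℂ) + 1) ^ 4 - a ^ 2 * ((m : ℂ) + 1) ^ 2 - b ^ 4 ≠ 0 := by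
  have hx : (1 : ℝ) ≤ (m : ℝ) + 1 := by linarith [(m.cast_nonneg : (0 : ℝ) ≤ m)]
  have h := cohenRivoal_norm_P_ge a b hx
  have hpos : 0 < ((m : ℝ) + 1) ^ 2 * (((m : ℝ) + 1) ^ 2 - (‖a‖ ^ 2 + ‖b‖ ^ 4)) :=
    mul_pos (by positivity) (by nlinarith)
  intro h0
  have e : ((((m : ℝ) + 1 : ℝ)) : ℂ) = (m : ℂ) + 1 := by push_cast; ring
  rw [e, h0, norm_zero] at h
  linarith

/-- **The Markov–WZ relation** `F(n+1,k) − F(n,k) = G(n,k+1) − G(n,k)` for the Cohen–Rivoal pair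
(the source's (eq04) with (eq06)–(eq14) at `B₀ = 1`, `A₀ = C₀ = 0`, `L ≡ 0`), valid whenever `P(m) ≠ 0` for all
`m ≥ 1`. [cite: HessamiPilehrood2008MarkovWZ, §2 (eq04)–(eq14) with B₀ = 1, A₀ = C₀ = 0] -/
theorem cohenRivoal_wz {a b : ℂ} (hP : ∀ m : ℕ, ((m : ℂ) + 1) ^ 4 - a ^ 2 * ((m : ℂ) + 1) ^ 2 - b ^ 4 ≠ 0) (n k : ℕ) :
    let F : ℕ → ℕ → ℂ := fun n k =>
      ((-1 : ℂ) ^ n * (n.factorial : ℂ) / 2 ^ (n + 1) *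
        ∏ m ∈ range n, ((((m : ℂ) + 1) ^ 2 - a ^ 2) ^ 2 + 4 * b ^ 4) / (2 * ((m : ℂ) + 1) + 1)) *
        ((2 * (n : ℂ) + 1) * ((n : ℂ) + 2 * k + 2)) * (∏ i ∈ range (n + 1), (((k : ℂ) + 1 + i) ^ 4 - a ^ 2 * ((k : ℂ) + 1 + i) ^ 2 - b ^ 4))⁻¹
    let G : ℕ → ℕ → ℂ := fun n k =>
      ((-1 : ℂ) ^ n * (n.factorial : ℂ) / 2 ^ (n + 1) *
        ∏ m ∈ range n, ((((m : ℂ) + 1) ^ 2 - a ^ 2) ^ 2 + 4 * b ^ 4) / (2 * ((m : ℂ) + 1) + 1)) *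
        ((5 * ((n : ℂ) + 1) ^ 2 - a ^ 2) / 2 + 3 * ((n : ℂ) + 1) * k + (k : ℂ) ^ 2) * (∏ i ∈ range (n + 1), (((k : ℂ) + 1 + i) ^ 4 - a ^ 2 * ((k : ℂ) + 1 + i) ^ 2 - b ^ 4))⁻¹
    F (n + 1) k - F n k = G n (k + 1) - G n k := by
  intro F G
  simp only [F, G]
  -- the new factors under `n ↦ n+1` and `k ↦ k+1`
  have hP1 : ((k : ℂ) + 1) ^ 4 - a ^ 2 * ((k : ℂ) + 1) ^ 2 - b ^ 4 ≠ 0 := hP k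
  have hP2 : ((k : ℂ) + 1 + ((n : ℂ) + 1)) ^ 4 - a ^ 2 * ((k : ℂ) + 1 + ((n : ℂ) + 1)) ^ 2 - b ^ 4 ≠ 0 := by
    have h := hP (k + n + 1); push_cast at h; ring_nf at h ⊢; exact h
  have hPP : (∏ i ∈ range (n + 1), (((k : ℂ) + 1 + i) ^ 4 - a ^ 2 * ((k : ℂ) + 1 + i) ^ 2 - b ^ 4)) ≠ 0 :=
    prod_ne_zero_iff.2 fun i _ => by have h := hP (k + i); push_cast at h; ring_nf at h ⊢; exact h
  -- shift of the `P`-product in `n`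
  have ePn : ∏ i ∈ range (n + 1 + 1), (((k : ℂ) + 1 + i) ^ 4 - a ^ 2 * ((k : ℂ) + 1 + i) ^ 2 - b ^ 4) = (∏ i ∈ range (n + 1), (((k : ℂ) + 1 + i) ^ 4 - a ^ 2 * ((k : ℂ) + 1 + i) ^ 2 - b ^ 4)) * (((k : ℂ) + 1 + ((n : ℂ) + 1)) ^ 4 - a ^ 2 * ((k : ℂ) + 1 + ((n : ℂ) + 1)) ^ 2 - b ^ 4) := by
    rw [prod_range_succ]; push_cast; ring
  -- shift of the `P`-product in `k`
  have ePk : ∏ i ∈ range (n + 1), (((((k + 1 : ℕ)) : ℂ) + 1 + i) ^ 4 - a ^ 2 * ((((k + 1 : ℕ)) : ℂ) + 1 + i) ^ 2 - b ^ 4) = (∏ i ∈ range (n + 1), (((k : ℂ) + 1 + i) ^ 4 - a ^ 2 * ((k : ℂ) + 1 + i) ^ 2 - b ^ 4)) * (((k : ℂ) + 1 + ((n : ℂ) + 1)) ^ 4 - a ^ 2 * ((k : ℂ) + 1 + ((n : ℂ) + 1)) ^ 2 - b ^ 4) / (((k : ℂ) + 1) ^ 4 - a ^ 2 * ((k : ℂ)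 + 1) ^ 2 - b ^ 4) := by
    rw [eq_div_iff hP1]
    have h := prod_range_succ' (fun i : ℕ => (((k : ℂ) + 1 + i) ^ 4 - a ^ 2 * ((k : ℂ) + 1 + i) ^ 2 - b ^ 4)) (n + 1)
    rw [prod_range_succ] at h
    have e : ∏ i ∈ range (n + 1), (((((k + 1 : ℕ)) : ℂ) + 1 + i) ^ 4 - a ^ 2 * ((((k + 1 : ℕ)) : ℂ) + 1 + i) ^ 2 - b ^ 4) = ∏ i ∈ range (n + 1), (((k : ℂ) + 1 + (((i + 1 : ℕ)) : ℂ)) ^ 4 - a ^ 2 * ((k : ℂ) + 1 + (((i + 1 : ℕ)) : ℂ)) ^ 2 - b ^ 4) :=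
      prod_congr rfl fun i _ => by push_cast; ring
    rw [e]
    push_cast at h ⊢
    simp only [add_zero] at h
    linear_combination -h
  -- shift of `κ` in `n`
  have eκ : ∏ m ∈ range (n + 1), ((((m : ℂ) + 1) ^ 2 - a ^ 2) ^ 2 + 4 * b ^ 4) / (2 * ((m : ℂ) + 1) + 1) =
      (∏ m ∈ range n, ((((m : ℂ) + 1) ^ 2 - a ^ 2) ^ 2 + 4 * b ^ 4) / (2 * ((m : ℂ) + 1) + 1)) * (((((n : ℂ) + 1) ^ 2 - a ^ 2) ^ 2 + 4 * b ^ 4) / (2 * ((n : ℂ) + 1) + 1)) := prod_range_succ _ n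
  have efac : ((n + 1).factorial : ℂ) = ((n : ℂ) + 1) * (n.factorial : ℂ) := by
    rw [Nat.factorial_succ]; push_cast; ring
  rw [ePn, ePk, eκ, efac, pow_succ (-1 : ℂ) n, pow_succ (2 : ℂ) (n + 1)]
  have h3 : (2 * ((n : ℂ) + 1) + 1) ≠ 0 := by norm_cast
  have h2 : (2 : ℂ) ^ (n + 1) ≠ 0 := pow_ne_zero _ two_ne_zero
  push_cast
  -- clear denominators with the `P`-values as atoms, then substitute them back
  set PP : ℂ := ∏ i ∈ range (n + 1), (((k : ℂ) + 1 + i) ^ 4 - a ^ 2 * ((k : ℂ) + 1 + i) ^ 2 - b ^ 4) with hPPdef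
  set ρ : ℂ := ∏ m ∈ range n, ((((m : ℂ) + 1) ^ 2 - a ^ 2) ^ 2 + 4 * b ^ 4) / (2 * ((m : ℂ) + 1) + 1) with hρdef
  set P1 : ℂ := (((k : ℂ) + 1) ^ 4 - a ^ 2 * ((k : ℂ) + 1) ^ 2 - b ^ 4) with hP1def
  set P2 : ℂ := (((k : ℂ) + 1 + ((n : ℂ) + 1)) ^ 4 - a ^ 2 * ((k : ℂ) + 1 + ((n : ℂ) + 1)) ^ 2 - b ^ 4) with hP2def
  set t : ℂ := 2 * ((n : ℂ) + 1) + 1 with htdef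
  field_simp
  rw [hP1def, hP2def]
  ring

/-- `F(0,k) = (k+1)/P(k+1)`: the general term of `Σ_{n ≥ 1} n/(n⁴ − a²n² − b⁴)`.
[cite: HessamiPilehrood2008MarkovWZ, §3 (Σ_k F(0,k))] -/
theorem cohenRivoal_F_zero (a b : ℂ) (k : ℕ) :
    let F : ℕ → ℕ → ℂ := fun n k =>
      ((-1 : ℂ) ^ n * (n.factorial : ℂ) / 2 ^ (n + 1) *
        ∏ m ∈ range n, ((((m : ℂ) + 1) ^ 2 - a ^ 2) ^ 2 + 4 * b ^ 4) / (2 * ((m : ℂ) + 1) + 1)) *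
        ((2 * (n : ℂ) + 1) * ((n : ℂ) + 2 * k + 2)) * (∏ i ∈ range (n + 1), (((k : ℂ) + 1 + i) ^ 4 - a ^ 2 * ((k : ℂ) + 1 + i) ^ 2 - b ^ 4))⁻¹
    F 0 k = ((k : ℂ) + 1) / (((k : ℂ) + 1) ^ 4 - a ^ 2 * ((k : ℂ) + 1) ^ 2 - b ^ 4) := by
  intro F
  simp only [F, Nat.cast_zero, zero_add, add_zero, prod_range_one, prod_range_zero, pow_zero, Nat.factorial_zero,
    Nat.cast_one, mul_zero, mul_one, one_mul, pow_one]
  ring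

/-- `2ⁿ n! ∏_{m<n} (2m+3) = (2n+1)!` (the odd double factorial). [folklore] -/
private theorem two_pow_mul_factorial_mul_prod_odd (n : ℕ) :
    (2 : ℂ) ^ n * (n.factorial : ℂ) * ∏ m ∈ range n, (2 * ((m : ℂ) + 1) + 1) = ((2 * n + 1).factorial : ℂ) := by
  induction n with
  | zero => simp
  | succ n ih =>
    rw [prod_range_succ, Nat.factorial_succ, show 2 * (n + 1) + 1 = (2 * n + 1) + 1 + 1 by ring,
      Nat.factorial_succ (2 * n + 1 + 1), Nat.factorial_succ (2 * n + 1)]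
    push_cast
    linear_combination (2 * ((n : ℂ) + 1) * (2 * (n : ℂ) + 3)) * ih

/-- `G(n,0) = ½ · rivoalTerm a b (n+1)`: the general term of the right-hand side of [Rivoal2004, Thm 1.1]
(`(−1)ⁿ n!/(2^{n+1} ∏_{m≤n}(2m+1)) = (−1)ⁿ n!²/(2 (2n+1)!) = ½ · (−1)ⁿ/((n+1) C(2n+2, n+1))`).
[cite: HessamiPilehrood2008MarkovWZ, §3 (Σ_n G(n,0))] [cite: Rivoal2004, Theorem 1.1 (1–4) p. 504] -/
theorem cohenRivoal_G_zero (a b : ℂ) (hP : ∀ m : ℕ, ((m : ℂ) + 1) ^ 4 - a ^ 2 * ((m : ℂ) + 1) ^ 2 - b ^ 4 ≠ 0)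
    (n : ℕ) :
    let G : ℕ → ℕ → ℂ := fun n k =>
      ((-1 : ℂ) ^ n * (n.factorial : ℂ) / 2 ^ (n + 1) *
        ∏ m ∈ range n, ((((m : ℂ) + 1) ^ 2 - a ^ 2) ^ 2 + 4 * b ^ 4) / (2 * ((m : ℂ) + 1) + 1)) *
        ((5 * ((n : ℂ) + 1) ^ 2 - a ^ 2) / 2 + 3 * ((n : ℂ) + 1) * k + (k : ℂ) ^ 2) * (∏ i ∈ range (n + 1), (((k : ℂ) + 1 + i) ^ 4 - a ^ 2 * ((k : ℂ) + 1 + i) ^ 2 - b ^ 4))⁻¹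
    G n 0 = 1 / 2 * rivoalTerm a b (n + 1) := by
  intro G
  simp only [G, rivoalTerm]
  -- `∏_{m ∈ Ico 1 (n+1)} R(m)/P(m) = ∏_{m<n} R(m+1)/P(m+1)` and `∏_{i<n+1} P(0+1+i) = (∏_{m<n} P(m+1)) · P(n+1)`
  have eIco : ∏ m ∈ Ico 1 (n + 1), ((((m : ℂ)) ^ 2 - a ^ 2) ^ 2 + 4 * b ^ 4) / (((m : ℂ)) ^ 4 - a ^ 2 * ((m : ℂ)) ^ 2 - b ^ 4) = ∏ m ∈ range n, ((((m : ℂ) + 1) ^ 2 - a ^ 2) ^ 2 + 4 * b ^ 4) / (((m : ℂ) + 1) ^ 4 - a ^ 2 * ((m : ℂ) + 1) ^ 2 - b ^ 4) := by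
    rw [prod_Ico_eq_prod_range, Nat.add_sub_cancel]
    exact prod_congr rfl fun m _ => by push_cast; ring
  have ePP : ∏ i ∈ range (n + 1), ((((0 : ℕ) : ℂ) + 1 + i) ^ 4 - a ^ 2 * (((0 : ℕ) : ℂ) + 1 + i) ^ 2 - b ^ 4) = (∏ m ∈ range n, (((m : ℂ) + 1) ^ 4 - a ^ 2 * ((m : ℂ) + 1) ^ 2 - b ^ 4)) * (((n : ℂ) + 1) ^ 4 - a ^ 2 * ((n : ℂ) + 1) ^ 2 - b ^ 4) := by
    rw [prod_range_succ]
    exact congrArg₂ (· * ·) (prod_congr rfl fun m _ => by push_cast; ring) (by push_cast; ring)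
  -- `2^n n! ∏_{m<n} (2m+3) = (2n+1)!` and `C(2n+2,n+1) (n+1)!² = (2n+2)!`
  have eodd := two_pow_mul_factorial_mul_prod_odd n
  have eC : (((n + 1).centralBinom : ℕ) : ℂ) * (((n : ℂ) + 1) * (n.factorial : ℂ)) ^ 2 =
      (2 * (n : ℂ) + 2) * ((2 * n + 1).factorial : ℂ) := by
    have h := Nat.choose_mul_factorial_mul_factorial (show n + 1 ≤ 2 * (n + 1) by omega)
    rw [show 2 * (n + 1) - (n + 1) = n + 1 by omega, ← Nat.centralBinom_eq_two_mul_choose,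
      show 2 * (n + 1) = (2 * n + 1) + 1 by ring, Nat.factorial_succ (2 * n + 1), Nat.factorial_succ n] at h
    have h' : (((n + 1).centralBinom : ℕ) : ℂ) * (((n : ℂ) + 1) * (n.factorial : ℂ)) * (((n : ℂ) + 1) * (n.factorial : ℂ)) =
        (2 * (n : ℂ) + 1 + 1) * ((2 * n + 1).factorial : ℂ) := by exact_mod_cast h
    linear_combination h'
  rw [eIco, ePP, prod_div_distrib, prod_div_distrib]
  have hPprod : ∏ m ∈ range n, (((m : ℂ) + 1) ^ 4 - a ^ 2 * ((m : ℂ) + 1) ^ 2 - b ^ 4) ≠ 0 := prod_ne_zero_iff.2 fun m _ => hP m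
  have hPN : (((n : ℂ) + 1) ^ 4 - a ^ 2 * ((n : ℂ) + 1) ^ 2 - b ^ 4) ≠ 0 := hP n
  have hC : (((n + 1).centralBinom : ℕ) : ℂ) ≠ 0 := by exact_mod_cast (Nat.centralBinom_pos (n + 1)).ne'
  have hfac : ((2 * n + 1).factorial : ℂ) ≠ 0 := by exact_mod_cast (Nat.factorial_pos _).ne'
  have hnf : (n.factorial : ℂ) ≠ 0 := by exact_mod_cast (Nat.factorial_pos _).ne'
  have hn1 : ((n : ℂ) + 1) ≠ 0 := by norm_cast
  have hodd : ∏ m ∈ range n, (2 * ((m : ℂ) + 1) + 1) ≠ 0 := prod_ne_zero_iff.2 fun m _ => by norm_cast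
  set PPr : ℂ := ∏ m ∈ range n, (((m : ℂ) + 1) ^ 4 - a ^ 2 * ((m : ℂ) + 1) ^ 2 - b ^ 4)
  set RPr : ℂ := ∏ m ∈ range n, ((((m : ℂ) + 1) ^ 2 - a ^ 2) ^ 2 + 4 * b ^ 4)
  set O : ℂ := ∏ m ∈ range n, (2 * ((m : ℂ) + 1) + 1) with hO
  have eO : O = ((2 * n + 1).factorial : ℂ) / (2 ^ n * (n.factorial : ℂ)) := by
    rw [eq_div_iff (mul_ne_zero (pow_ne_zero _ two_ne_zero) hnf)]; linear_combination eodd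
  have eC' : (((n + 1).centralBinom : ℕ) : ℂ) =
      (2 * (n : ℂ) + 2) * ((2 * n + 1).factorial : ℂ) / (((n : ℂ) + 1) * (n.factorial : ℂ)) ^ 2 := by
    rw [eq_div_iff (pow_ne_zero _ (mul_ne_zero hn1 hnf))]; linear_combination eC
  push_cast
  rw [show ((-1 : ℂ)) ^ (n + 1 + 1) = (-1) ^ n by rw [pow_succ, pow_succ]; ring, eO, eC']
  have h22 : (2 * (n : ℂ) + 2) ≠ 0 := by norm_cast
  have h2n : (2 : ℂ) ^ n ≠ 0 := pow_ne_zero _ two_ne_zero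
  set Pn : ℂ := (((n : ℂ) + 1) ^ 4 - a ^ 2 * ((n : ℂ) + 1) ^ 2 - b ^ 4) with hPndef
  field_simp
  ring

end Literature.NumberTheory.ZetaValues
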